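import Summits.CriticalPhenomena.PercolationContinuityZ3.Theorems.PercNearOneGluingNoHeavyLowerTailSahiOneStep
import Summits.CriticalPhenomena.PercolationContinuityZ3.Theorems.PercNearOneGluingNoHeavyLowerTailSahiE3Sections
import HarnessLib

/-!
# One-step scheme: the CYLINDER instance `H = {F ⊆ ω}` (sanity check that the hypotheses are satisfiable; known theorem)

Support file (prover prim-ineq-prove-3 gen 14; `--supports stmt-CriticalPhenomena-4575`; memo `run/shared/lean/prim/prim-ineq-prove-3/FINDING-G14-ONESTEP-THRESHOLD.md`).
No definitions, no named facts, no sorries.  For the cylinder `H = {F ⊆ ω}` and core test functions `φ, ψ` (top values `φ̄ = φ(F)`,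
`ψ̄ = ψ(F)`, `c = P(H)`): `m′(φ,ψ) = c(φ̄ψ̄ − E[φψ]) ≥ 0` and `n(φ,ψ) = c(φ̄ − Eφ)(ψ̄ − Eψ) ≥ 0` (`oneStepPos_cylinder`), whence
`sahiE3_cylinder_nonneg_oneStep`: `0 ≤ E₃({F ⊆ ω}, A, B)` for all increasing `A, B` — Kahn's Conjecture 5 with a cylinder slot, already in
the tree as `…SahiCombStrata`; recorded here as the end-to-end test of `…SahiOneStep.sahiE3_nonneg_of_oneStepPos`.
-/

noncomputable section

namespace Summit.CriticalPhenomena.PercolationContinuityZ3.Theorems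

namespace SahiOneStep

open Literature.Combinatorics.Sahi2008
open Literature.Probability.Percolation (DeterminedBy determinedBy_iff)
open Literature.Probability.Percolation.DecisionTree (ind ind_of_mem ind_of_not_mem ind_nonneg)
open Literature.Probability.Percolation.BHK2006 (weight weight_nonneg blockFubini harris)
open Literature.Probability.LatticeModels (prodBernoulli sahiE3 sahiE3_def)
open SahiCdd (sec ex_congr' ex_lin2 ex_lin4 ex_split ex_mul_split sec_insert_of_not_mem sec_insert_insert
  sec_comp_insert sec_comp_sdiff sec_apply_insert sec_apply_sdiff monotone_sec dep_insert dep_sdiff ex_mul_le_ex_mul)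

variable {ι : Type*} [Fintype ι] [DecidableEq ι]

/-! ## Instance (sanity check of the hypotheses): the CYLINDER first slot `H = {F ⊆ ω}` -/

omit [Fintype ι] [DecidableEq ι] in
/-- On the cylinder a core test function is constant, equal to its top value `φ(F)`: `1_H·φ = φ(F)·1_H`. [this work] -/
theorem ind_cylinder_mul_core {F : Finset ι} {φ : Set ι → ℝ} (hφ : ∀ ω, φ ω = φ (ω ∩ (F : Set ι))) (ω : Set ι) :
    (ind {ω : Set ι | (F : Set ι) ⊆ ω} * φ) ω = φ (F : Set ι) * ind {ω : Set ι | (F : Set ι) ⊆ ω} ω := by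
  simp only [Pi.mul_apply]
  by_cases h : ω ∈ {ω : Set ι | (F : Set ι) ⊆ ω}
  · have hωF : ω ∩ (F : Set ι) = (F : Set ι) := Set.inter_eq_right.2 h
    rw [ind_of_mem h, hφ ω, hωF]; ring
  · rw [ind_of_not_mem h]; ring

omit [Fintype ι] [DecidableEq ι] in
/-- A core test function is bounded by its top value: `φ(ω) ≤ φ(F)`. [this work] -/
theorem core_le_top {F : Finset ι} {φ : Set ι → ℝ} (hφm : Monotone φ) (hφ : ∀ ω, φ ω = φ (ω ∩ (F : Set ι))) (ω : Set ι) :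
    φ ω ≤ φ (F : Set ι) := by
  rw [hφ ω]; exact hφm Set.inter_subset_right

omit [DecidableEq ι] in
/-- **The cylinder satisfies the one-step positivity hypothesis**: with `c = π(F ⊆ ω)` and `φ̄ = φ(F)`,
`m′(φ,ψ) = c·(φ̄ψ̄ − E[φψ]) ≥ 0` and `n(φ,ψ) = c·(φ̄ − Eφ)(ψ̄ − Eψ) ≥ 0`. [this work] -/
theorem oneStepPos_cylinder (p : ι → unitInterval) (F : Finset ι) :
    OneStepPos p {ω : Set ι | (F : Set ι) ⊆ ω} F := by
  intro φ ψ hφ hψ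
  set H : Set (Set ι) := {ω : Set ι | (F : Set ι) ⊆ ω} with hH
  set μ := bernoulliWeight p with hμ
  obtain ⟨hφm, hφ01, hφF⟩ := hφ
  obtain ⟨hψm, hψ01, hψF⟩ := hψ
  have hμ0 : ∀ ω, 0 ≤ μ ω := fun ω => weight_nonneg (fun i => (p i).2.1) (fun i => (p i).2.2) ω
  have hμ1 : ∑ ω, μ ω = 1 := sum_bernoulliWeight p
  set c := ex μ (ind H) with hc
  set a := φ (F : Set ι) with ha
  set b := ψ (F : Set ι) with hb
  -- the `1_H`-weighted expectations collapse to the top values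
  have e1 : ex μ (ind H * φ) = a * c := by
    rw [ex_congr' (fun ω => show (ind H * φ) ω = a * ind H ω + 0 * ind H ω from by
      rw [ind_cylinder_mul_core hφF]; ring), ex_lin2]; ring
  have e2 : ex μ (ind H * ψ) = b * c := by
    rw [ex_congr' (fun ω => show (ind H * ψ) ω = b * ind H ω + 0 * ind H ω from by
      rw [ind_cylinder_mul_core hψF]; ring), ex_lin2]; ring
  have hφψF : ∀ ω, (φ * ψ) ω = (φ * ψ) (ω ∩ (F : Set ι)) := fun ω => by
    simp only [Pi.mul_apply]; rw [hφF ω, hψF ω]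
  have e3 : ex μ (ind H * φ * ψ) = a * b * c := by
    have : ind H * φ * ψ = ind H * (φ * ψ) := by rw [mul_assoc]
    rw [this, ex_congr' (fun ω => show (ind H * (φ * ψ)) ω = (a * b) * ind H ω + 0 * ind H ω from by
      rw [ind_cylinder_mul_core hφψF]; simp only [Pi.mul_apply]; ring), ex_lin2]; ring
  -- elementary bounds
  have hc0 : 0 ≤ c := ex_nonneg hμ0 fun ω => ind_nonneg _ _
  have hEφ : ex μ φ ≤ a := by
    calc ex μ φ ≤ ex μ (fun _ => a) := ex_mono hμ0 fun ω => core_le_top hφm hφF ω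
      _ = a := ex_const hμ1 a
  have hEψ : ex μ ψ ≤ b := by
    calc ex μ ψ ≤ ex μ (fun _ => b) := ex_mono hμ0 fun ω => core_le_top hψm hψF ω
      _ = b := ex_const hμ1 b
  have hEφψ : ex μ (φ * ψ) ≤ a * b := by
    calc ex μ (φ * ψ) ≤ ex μ (fun _ => a * b) := ex_mono hμ0 fun ω => by
            simp only [Pi.mul_apply]
            exact mul_le_mul (core_le_top hφm hφF ω) (core_le_top hψm hψF ω) (hψ01 ω).1
              ((hφ01 ω).1.trans (core_le_top hφm hφF ω))
      _ = a * b := ex_const hμ1 (a * b)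
  constructor
  · -- m′ = c (ab − E[φψ])
    unfold osMp osCert
    rw [osD_eq]
    have : ind H * (φ * ψ) = ind H * φ * ψ := by rw [mul_assoc]
    rw [this, e3, e1, e2]
    nlinarith [mul_nonneg hc0 (sub_nonneg.2 hEφψ)]
  · -- n = c (a − Eφ)(b − Eψ)
    unfold osN osCert
    rw [e3, e1, e2]
    nlinarith [mul_nonneg hc0 (mul_nonneg (sub_nonneg.2 hEφ) (sub_nonneg.2 hEψ))]

omit [DecidableEq ι] in
/-- **Corollary (known: `…SahiCombStrata`; here a five-line consequence of the one-step scheme):** Kahn's Conjecture 5 / Sahi's `C₃`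
for the first slot a CYLINDER `{F ⊆ ω}` and two arbitrary increasing events, every product measure, every dimension. [this work] -/
theorem sahiE3_cylinder_nonneg_oneStep (p : ι → unitInterval) (F : Finset ι) {A B : Set (Set ι)}
    (hA : IsUpperSet A) (hB : IsUpperSet B) :
    0 ≤ sahiE3 (prodBernoulli p) {ω : Set ι | (F : Set ι) ⊆ ω} A B :=
  sahiE3_nonneg_of_oneStepPos p (SahiE3Sections.determinedBy_cyl F) (oneStepPos_cylinder p F) hA hB

end SahiOneStep

end Summit.CriticalPhenomena.PercolationContinuityZ3.Theorems
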